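import Summits.QuantumFields.YangMills.Theorems.LatticeGapInUVUnitsC.Negative.ContinuousSlowRulers
import Summits.QuantumFields.YangMills.Theorems.LatticeGapInUVUnitsC.Negative.TendstoLoadBearing
import Summits.QuantumFields.YangMills.Theorems.LangevinControlUVFemtoCurvatureTwoPointAxisCovNonneg

/-!
# `LatticeGapInUVUnitsC` — the package's LOWER bound is load-bearing; continuity alone pins nothing

Negative-side file (cdisprove, cycle 1) for crux `stmt-QuantumFields-16206` =
`Summit.QuantumFields.YangMills.Theses.LangevinControlUV.LatticeGapInUVUnitsC` (route `LangevinControlUV`, rank 5),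
the repair C′ (`Continuous a →` inserted) of the parent crux `LatticeGapInUVUnits` (stmt-9366, refuted MODULO
`StandardScalingSU` by slow generic STEP rulers, `Negative/LatticeGapInUVUnitsFalseOfStandardScalingSU.lean`).

## Results (sorry-free; axioms `propext`, `Classical.choice`, `Quot.sound`)

* `exists_tame_threshold` (level `ε`), `exists_slow_continuous_ruler_above_covariances` (UNCONDITIONAL, from the
  proved weak-coupling concentration and `exists_continuous_slow_ruler`): for every `r`, above any sequence of
  couplings `S j` there is a CONTINUOUS antitone unit map `0 < a ≤ 1`, `a → 0`, `a (S j) ≥ 1/(j+1)`, such that in every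
  femto box `L a(β) ≤ 1` all the package's upper quantities are `< a β`; hence (`exists_slow_continuous_package_id`) it
  carries the UPPER half of the femto two-point package with the VANISHING shape `Γ(s) = s`, `C = 1`, `ℓ₀ = 1`,
  `β₀ = 0`, together with the sign-only lower clause (`c = 0`, the landed RP theorem `axisPlaquetteCov_nonneg`).
* THE UPPER-ONLY CRUX (the body of `LatticeGapInUVUnitsC` with the LOWER bound
  `c * Γ ((n : ℝ) * a β) ≤ (n : ℝ) ^ 8 * cov (P 0 0 1) (P (Pi.single 2 n) 0 1)` deleted, written INLINE — no named Prop
  is introduced for a statement believed false): it implies the crux (`latticeGapInUVUnitsC_of_upperOnly`), and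
  `latticeGapInUVUnitsC_upperOnly_false_of_xiUnbounded : XiUnbounded (suFund N) → ¬ (upper-only crux)` for every
  `N ≥ 2` (`H = XiUnbounded (suFund N)`, the parent file's `@[conjecture]` = the weak infrared half of
  `StandardScalingSU`, taken as an explicit hypothesis; NO ultraviolet hypothesis — the parent's `FixedTorusTwoSided`
  served only the lower bound, deleted here).
* THE SIGN-ONLY CRUX (`0 < c` weakened to `0 ≤ c`, inline): implies the crux (`latticeGapInUVUnitsC_of_signOnly`)
  and is FALSE modulo `XiUnbounded (suFund N)` (`latticeGapInUVUnitsC_signOnly_false_of_xiUnbounded`): with `c = 0`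
  the lower clause is the landed reflection-positivity theorem `axisPlaquetteCov_nonneg`. The lower clause must
  carry SIZE, not only SIGN — and no regularity of `Γ` (monotone, continuous, `Γ(0⁺) = 0`) substitutes for it.
* `not_concl_of_xiUnbounded_of_slow` — the IR bookkeeping (bad couplings `βs j ≥ j + 1` with clustering slower than
  rate `1/(j+1)²`; no ruler with `a (βs j) ≥ 1/(j+1)` clusters at a rate `c₁ a(β)`); and its corollary
  `not_forall_continuous_concl_of_xiUnbounded`: modulo `H` NO clustering law in units `a` holds for ALL continuous
  rulers — so a crux skeleton `(∀ a continuous, X r a) → crux` with `X → Concl` (the ratchet sketch's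
  `latticeGapInUVUnitsC_of_ratchet`) has an unsatisfiable hypothesis unless its stubs consume the package.

## Reading (for the provers of the crux and of line `amplitude-exhaustion-ratchet`)

"Continuity pins the ruler to the physical scale" is, checkably, "continuity AND two-sidedness": with the lower bound
deleted, continuous rulers decay as slowly as one likes while carrying everything else in the hypothesis, and the item
collapses to `ξ(β) = O(1/a(β))` for parasitically slow `a`, i.e. to `ξ` BOUNDED. Hence any proof of
`LatticeGapInUVUnitsC` must consume `c Γ(n a β) ≤ n⁸ Cov` (the ratchet's seed does; a line whose stubs never mention
the lower bound is attacking `XiUnbounded`). Not a refutation: the weakened statement is strictly stronger than the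
item (standing Disproof verdict: no kill; `Cruxes/LatticeGapInUVUnitsC/Disproof.lean`).
-/

namespace Summit.QuantumFields.YangMills.Theorems.LatticeGapInUVUnitsC.Negative

open Filter Topology MeasureTheory
open Literature.MathematicalPhysics.QuantumFieldTheory Literature.MathematicalPhysics.QuantumLattice
open Summit.QuantumFields.YangMills.Theses.LangevinControlUV (LatticeGapInUVUnitsC)
open Summit.QuantumFields.YangMills.Theorems.LatticeGapInUVUnits.Negative
open Summit.QuantumFields.YangMills.Theorems.FemtoCurvatureTwoPoint.AxisCovNonneg (axisPlaquetteCov_nonneg)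

noncomputable section

section Gauge

variable {G : Type} [Group G] [TopologicalSpace G] [IsTopologicalGroup G] [CompactSpace G]
  [MeasurableSpace G] [BorelSpace G]

/-- **Tameness threshold of a fixed torus at level `ε`.** Beyond some coupling `B(L, ε)` every quantity bounded ABOVE
by the femto two-point package is `≤ ε` on the torus of side `L`: `n⁸ Cov(P_0^{01}, P_{ne₂}^{01}) ≤ ε` (`1 ≤ n ≤ L/8`) and
`|Cov(P_x^{ij}, P_y^{i'j'})| · dist⁸ ≤ ε` — finitely many covariances, each tending to `0` (proved concentration).
[folklore] -/
theorem exists_tame_threshold (r : LatticeRep G) (L : ℕ) [NeZero L] {ε : ℝ} (hε : 0 < ε) :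
    ∃ B : ℝ, ∀ β : ℝ, B ≤ β →
      (∀ n : ℕ, 1 ≤ n → 8 * n ≤ L → (n : ℝ) ^ 8 * axisCov r L β n ≤ ε) ∧
        ∀ (x y : Site 4 L) (i j i' j' : Fin 4), x ≠ y → i ≠ j → i' ≠ j' →
          |wcov r β (plaqField r x i j) (plaqField r y i' j')| * torusDist x y ^ 8 ≤ ε := by
  -- axis conditions, indexed by `Fin (L + 1)`
  have hax : ∀ᶠ β in atTop, ∀ n : Fin (L + 1), ((n : ℕ) : ℝ) ^ 8 * axisCov r L β n ≤ ε := by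
    refine eventually_all.2 fun n => ?_
    have ht : Tendsto (fun β => ((n : ℕ) : ℝ) ^ 8 * axisCov r L β n) atTop (𝓝 0) := by
      simpa [axisCov] using (tendsto_wcov_plaqField r L (0 : Site 4 L)
        (Pi.single (2 : Fin 4) (((n : ℕ) : ℕ) : ZMod L))
        (show (0 : Fin 4) ≠ 1 by decide) (show (0 : Fin 4) ≠ 1 by decide)).const_mul (((n : ℕ) : ℝ) ^ 8)
    exact (ht.eventually (gt_mem_nhds hε)).mono fun β hβ => hβ.le
  -- pair conditions, indexed by a finite type
  have hpr : ∀ᶠ β in atTop, ∀ q : (Site 4 L × Site 4 L) × ((Fin 4 × Fin 4) × (Fin 4 × Fin 4)),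
      q.2.1.1 ≠ q.2.1.2 → q.2.2.1 ≠ q.2.2.2 →
        |wcov r β (plaqField r q.1.1 q.2.1.1 q.2.1.2) (plaqField r q.1.2 q.2.2.1 q.2.2.2)| *
          torusDist q.1.1 q.1.2 ^ 8 ≤ ε := by
    refine eventually_all.2 fun q => ?_
    by_cases h1 : q.2.1.1 ≠ q.2.1.2
    · by_cases h2 : q.2.2.1 ≠ q.2.2.2
      · have ht : Tendsto (fun β => |wcov r β (plaqField r q.1.1 q.2.1.1 q.2.1.2)
            (plaqField r q.1.2 q.2.2.1 q.2.2.2)| * torusDist q.1.1 q.1.2 ^ 8) atTop (𝓝 0) := by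
          simpa using ((tendsto_wcov_plaqField r L q.1.1 q.1.2 h1 h2).abs).mul_const (torusDist q.1.1 q.1.2 ^ 8)
        exact (ht.eventually (gt_mem_nhds hε)).mono fun β hβ _ _ => hβ.le
      · exact Eventually.of_forall fun β _ h => absurd h h2
    · exact Eventually.of_forall fun β h _ => absurd h h1
  obtain ⟨B, hB⟩ := eventually_atTop.1 (hax.and hpr)
  refine ⟨B, fun β hβ => ⟨fun n _ hnL => ?_, fun x y i j i' j' _ hij hij' => ?_⟩⟩
  · have hn : n < L + 1 := by omega
    exact (hB β hβ).1 ⟨n, hn⟩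
  · exact (hB β hβ).2 ((x, y), ((i, j), (i', j'))) hij hij'

omit [TopologicalSpace G] [IsTopologicalGroup G] [CompactSpace G] [MeasurableSpace G] [BorelSpace G] in
/-- Distinct torus sites are at distance `≥ 1`. [folklore] -/
theorem one_le_torusDist {L : ℕ} [NeZero L] {x y : Site 4 L} (hxy : x ≠ y) : 1 ≤ torusDist x y := by
  obtain ⟨m, hm, h⟩ := torusDist_eq_sqrt hxy
  rw [h, Real.one_le_sqrt]
  exact_mod_cast hm

/-- **A slow CONTINUOUS ruler lies ABOVE every femto covariance — unconditionally.** For every `r` and every sequence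
of couplings `S j` there is a continuous antitone unit map `0 < a ≤ 1`, `a → 0`, with `a (S j) ≥ 1/(j+1)`, such that in
EVERY box that is femto for `a` at `β` (`L a(β) ≤ 1`, any `β`) all the quantities the femto two-point package bounds
above are `< a(β)`: `n⁸ Cov_{β,L}(P_0^{01}, P_{ne₂}^{01}) < a β` (`1 ≤ n ≤ L/8`) and `|Cov| dist⁸ < a β` (all pairs).
Construction: tameness thresholds `B(L', 1/(L+1))` of all tori `L' ≤ L` folded into the ruler's threshold `T L`
(`exists_continuous_slow_ruler`); at `β` the largest femto box `L* = ⌊1/a β⌋` is tame at level `1/(L*+1) < a β`, and so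
is every smaller torus; the box `L = 1` is vacuous. Only the proved concentration enters. [folklore] -/
theorem exists_slow_continuous_ruler_above_covariances (r : LatticeRep G) (S : ℕ → ℝ) :
    ∃ a : ℝ → ℝ, Continuous a ∧ Antitone a ∧ (∀ β, 0 < a β) ∧ (∀ β, a β ≤ 1) ∧ Tendsto a atTop (𝓝 0) ∧
      (∀ (L : ℕ) [NeZero L] (β : ℝ), (L : ℝ) * a β ≤ 1 →
        (∀ n : ℕ, 1 ≤ n → 8 * n ≤ L → (n : ℝ) ^ 8 * axisCov r L β n < a β) ∧
          ∀ (x y : Site 4 L) (i j i' j' : Fin 4), x ≠ y → i ≠ j → i' ≠ j' →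
            |wcov r β (plaqField r x i j) (plaqField r y i' j')| * torusDist x y ^ 8 < a β) ∧
      ∀ j : ℕ, 1 / ((j : ℝ) + 1) ≤ a (S j) := by
  -- tameness threshold of the torus of side `m + 1` at level `1/(q+1)`
  have hth : ∀ q m : ℕ, ∃ B : ℝ, ∀ β : ℝ, B ≤ β →
      (∀ n : ℕ, 1 ≤ n → 8 * n ≤ m + 1 → (n : ℝ) ^ 8 * axisCov r (m + 1) β n ≤ 1 / ((q : ℝ) + 1)) ∧
        ∀ (x y : Site 4 (m + 1)) (i j i' j' : Fin 4), x ≠ y → i ≠ j → i' ≠ j' →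
          |wcov r β (plaqField r x i j) (plaqField r y i' j')| * torusDist x y ^ 8 ≤ 1 / ((q : ℝ) + 1) :=
    fun q m => exists_tame_threshold r (m + 1) (by positivity)
  choose B hB using hth
  -- fold the thresholds of all tori `≤ L` at level `1/(L+1)` into `T L`
  let T : ℕ → ℝ := fun L => ∑ i ∈ Finset.range L, max (B L i) 0
  have hT : ∀ {L m : ℕ}, m < L → B L m ≤ T L := fun {L m} hm =>
    (le_max_left _ _).trans (Finset.single_le_sum (f := fun i => max (B L i) 0) (fun i _ => le_max_right _ _)
      (Finset.mem_range.2 hm))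
  obtain ⟨a, ha, hanti, hpos, hle1, hlim, hfemto, hslow⟩ := exists_continuous_slow_ruler T S
  refine ⟨a, ha, hanti, hpos, hle1, hlim, fun L _ β hL => ?_, hslow⟩
  -- the largest femto box `L*` at `β`
  set Ls : ℕ := ⌊1 / a β⌋₊ with hLs
  have haβ := hpos β
  have hLle : L ≤ Ls := by
    refine Nat.le_floor ?_
    rw [le_div_iff₀ haβ]
    exact hL
  have hlevel : 1 / ((Ls : ℝ) + 1) < a β := by
    rw [one_div_lt (by positivity) haβ]
    exact Nat.lt_floor_add_one _
  obtain ⟨m, rfl⟩ : ∃ m, L = m + 1 := ⟨L - 1, (Nat.succ_pred_eq_of_ne_zero (NeZero.ne L)).symm⟩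
  rcases lt_or_ge Ls 2 with hsmall | hLs2
  · -- only the box `L = 1` is femto, and it is vacuous
    have hm0 : m = 0 := by omega
    subst hm0
    haveI : Subsingleton (Site 4 (0 + 1)) := by rw [Nat.zero_add]; infer_instance
    refine ⟨fun n hn hnL => by omega, fun x y i j i' j' hxy => ?_⟩
    exact absurd (Subsingleton.elim x y) hxy
  · have hLsa : (Ls : ℝ) * a β ≤ 1 := by
      have h1 : (Ls : ℝ) ≤ 1 / a β := Nat.floor_le (by positivity)
      rwa [le_div_iff₀ haβ] at h1
    have hβ : B Ls m ≤ β := ((hT (by omega)).trans (hfemto β Ls hLs2 hLsa).le)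
    obtain ⟨hax, hpr⟩ := hB Ls m β hβ
    exact ⟨fun n hn hnL => (hax n hn hnL).trans_lt hlevel,
      fun x y i j i' j' hxy hij hij' => (hpr x y i j i' j' hxy hij hij').trans_lt hlevel⟩

/-- **Slow continuous rulers carry the sign-only femto package with the vanishing shape `Γ(s) = s` —
unconditionally.** For every `r` and couplings `S j`: a continuous unit map `a > 0`, `a → 0`, `a (S j) ≥ 1/(j+1)`, such
that on every femto box (`L a(β) ≤ 1`, `β ≥ 0`): lower axis clause with `c = 0` (the landed reflection-positivity
theorem `axisPlaquetteCov_nonneg`), upper axis clause `n⁸ Cov ≤ C Γ(n a β)` and all-pairs clause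
`|Cov| dist⁸ ≤ C Γ(dist · a β)` with `C = 1` and `Γ(s) = s` (continuous, strictly increasing, `Γ(0⁺) = 0` — the
qualitative profile of the physical shape): everything is `< a β ≤ n a β`, `dist ≥ 1`. So neither continuity of the
ruler NOR any regularity / vanishing requirement on the shape can replace the SIZE of the lower clause. [folklore] -/
theorem exists_slow_continuous_package_id (r : LatticeRep G) (S : ℕ → ℝ) :
    ∃ a : ℝ → ℝ, Continuous a ∧ (∀ β, 0 < a β) ∧ Tendsto a atTop (𝓝 0) ∧
      (∀ (L : ℕ) [NeZero L] (β : ℝ), 0 ≤ β → (L : ℝ) * a β ≤ 1 →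
        (∀ n : ℕ, 1 ≤ n → 8 * n ≤ L →
            0 * ((n : ℝ) * a β) ≤ (n : ℝ) ^ 8 * axisCov r L β n ∧
              (n : ℝ) ^ 8 * axisCov r L β n ≤ 1 * ((n : ℝ) * a β)) ∧
          ∀ (x y : Site 4 L) (i j i' j' : Fin 4), x ≠ y → i ≠ j → i' ≠ j' →
            |wcov r β (plaqField r x i j) (plaqField r y i' j')| * torusDist x y ^ 8 ≤
              1 * (torusDist x y * a β)) ∧
      ∀ j : ℕ, 1 / ((j : ℝ) + 1) ≤ a (S j) := by
  obtain ⟨a, ha, -, hpos, -, hlim, hbox, hslow⟩ := exists_slow_continuous_ruler_above_covariances r S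
  refine ⟨a, ha, hpos, hlim, fun L _ β hβ hL => ?_, hslow⟩
  obtain ⟨hax, hpr⟩ := hbox L β hL
  refine ⟨fun n hn hnL => ⟨?_, ?_⟩, fun x y i j i' j' hxy hij hij' => ?_⟩
  · have h0 : 0 ≤ axisCov r L β n := axisPlaquetteCov_nonneg r.ρ r.continuous hβ n
    rw [zero_mul]
    positivity
  · have h1 : (1 : ℝ) ≤ n := by exact_mod_cast hn
    have h2 : a β ≤ (n : ℝ) * a β := le_mul_of_one_le_left (hpos β).le h1
    linarith [hax n hn hnL]
  · have h2 : a β ≤ torusDist x y * a β := le_mul_of_one_le_left (hpos β).le (one_le_torusDist hxy)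
    linarith [hpr x y i j i' j' hxy hij hij']

end Gauge

section IR

variable {G : Type} [Group G] [TopologicalSpace G] [IsTopologicalGroup G] [CompactSpace G]
  [MeasurableSpace G] [BorelSpace G]

/-- **IR bookkeeping.** From `XiUnbounded r`: a pair `(A, B)` and increasing couplings `βs j ≥ j + 1` at which the
pair clusters MORE SLOWLY than rate `1/(j+1)²` on large tori; hence no unit map with `a (βs j) ≥ 1/(j+1)` for all `j`
admits volume-uniform clustering at a rate `c₁ a(β)`, `c₁ > 0`. [folklore] -/
theorem not_concl_of_xiUnbounded_of_slow (r : LatticeRep G) (hXi : XiUnbounded r) :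
    ∃ βs : ℕ → ℝ, (∀ j : ℕ, (j : ℝ) + 1 ≤ βs j) ∧
      ∀ a : ℝ → ℝ, (∀ j : ℕ, 1 / ((j : ℝ) + 1) ≤ a (βs j)) →
        ¬ ∃ (c₁ β₂ : ℝ) (S₁ : ℝ → ℕ), 0 < c₁ ∧ ∀ A B : YMSpecies G, ∃ C : ℝ, ∀ β : ℝ, β₂ ≤ β →
            ∀ S n : ℕ, S₁ β ≤ S → n ≤ S →
              |latticeConnectedCorr r.ρ β (2 * S + 1) A.F B.F n| ≤ C * Real.exp (-(c₁ * a β * n)) := by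
  obtain ⟨A, B, hAB⟩ := hXi
  choose f hfb hf using hAB
  let ε : ℕ → ℝ := fun j => 1 / ((j : ℝ) + 1) ^ 2
  have hε : ∀ j, 0 < ε j := fun j => by positivity
  let βs : ℕ → ℝ := fun j => Nat.rec (f (ε 0) (hε 0) 1) (fun j b => f (ε (j + 1)) (hε (j + 1)) (b + 1)) j
  have hβs0 : βs 0 = f (ε 0) (hε 0) 1 := rfl
  have hβsS : ∀ j, βs (j + 1) = f (ε (j + 1)) (hε (j + 1)) (βs j + 1) := fun j => rfl
  have hβs_ge : ∀ j : ℕ, (j : ℝ) + 1 ≤ βs j := by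
    intro j
    induction j with
    | zero => simpa [hβs0] using hfb (ε 0) (hε 0) 1
    | succ j ih =>
      rw [hβsS]
      have := hfb (ε (j + 1)) (hε (j + 1)) (βs j + 1)
      push_cast
      linarith
  have hβs_clause : ∀ j (S₀ : ℕ) (C : ℝ), ∃ S : ℕ, S₀ ≤ S ∧ ∃ n : ℕ, n ≤ S ∧
      C * Real.exp (-(ε j * n)) < |latticeConnectedCorr r.ρ (βs j) (2 * S + 1) A.F B.F n| := by
    intro j
    cases j with
    | zero => rw [hβs0]; exact hf (ε 0) (hε 0) 1
    | succ j => rw [hβsS]; exact hf (ε (j + 1)) (hε (j + 1)) (βs j + 1)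
  refine ⟨βs, hβs_ge, fun a hslow => ?_⟩
  rintro ⟨c₁, β₂, S₁, hc₁, hABc⟩
  obtain ⟨C₁, hC₁⟩ := hABc A B
  -- an index `j` with `βs j ≥ β₂` and `1/(j+1) < c₁`
  obtain ⟨j, hj⟩ : ∃ j : ℕ, max β₂ (1 / c₁) < (j : ℝ) + 1 :=
    ⟨⌈max β₂ (1 / c₁)⌉₊, (Nat.le_ceil _).trans_lt (lt_add_one _)⟩
  have hβ₂ : β₂ ≤ βs j := ((le_max_left _ _).trans hj.le).trans (hβs_ge j)
  have hjc : 1 / ((j : ℝ) + 1) < c₁ := by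
    have h1 : 1 / c₁ < (j : ℝ) + 1 := (le_max_right _ _).trans_lt hj
    rw [div_lt_iff₀ hc₁] at h1
    rw [div_lt_iff₀ (by positivity)]
    linarith
  obtain ⟨S, hS, n, hn, hlt⟩ := hβs_clause j (S₁ (βs j)) (max C₁ 1)
  have hup := hC₁ _ hβ₂ S n hS hn
  have hpos1 : (0 : ℝ) < max C₁ 1 := lt_max_of_lt_right one_pos
  have hchain : max C₁ 1 * Real.exp (-(ε j * n)) < max C₁ 1 * Real.exp (-(c₁ * a (βs j) * n)) :=
    hlt.trans_le (hup.trans (mul_le_mul_of_nonneg_right (le_max_left _ _) (Real.exp_pos _).le))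
  have hexp : Real.exp (-(ε j * n)) < Real.exp (-(c₁ * a (βs j) * n)) :=
    lt_of_mul_lt_mul_left hchain hpos1.le
  rw [Real.exp_lt_exp] at hexp
  have hn0 : (0 : ℝ) ≤ n := Nat.cast_nonneg n
  have hεle : ε j ≤ c₁ * a (βs j) := by
    have hω1 : 1 / ((j : ℝ) + 1) ≤ a (βs j) := hslow j
    have hq : (0 : ℝ) < 1 / ((j : ℝ) + 1) := by positivity
    calc ε j = 1 / ((j : ℝ) + 1) * (1 / ((j : ℝ) + 1)) := by
          show 1 / ((j : ℝ) + 1) ^ 2 = _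
          rw [sq, one_div_mul_one_div]
      _ ≤ c₁ * a (βs j) := mul_le_mul hjc.le hω1 hq.le hc₁.le
  have : ε j * n ≤ c₁ * a (βs j) * n := mul_le_mul_of_nonneg_right hεle hn0
  linarith

/-- **No clustering law in units `a` can hold for ALL continuous rulers** (modulo `XiUnbounded r`): above the bad
couplings of `XiUnbounded` there is a continuous positive ruler `a → 0` with `a (βs j) ≥ 1/(j+1)`
(`exists_continuous_slow_ruler`), for which `Concl r a` fails. Consequence for skeletons of the crux: a composition
`(∀ a, Continuous a → 0 < a → a → 0 → X r a) → LatticeGapInUVUnitsC` with `X r a → Concl r a` (e.g. the ratchet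
sketch's `latticeGapInUVUnitsC_of_ratchet`, whose `RatchetData r a` yields `Concl r a` by `concl_of_ratchet`) has an
UNSATISFIABLE hypothesis modulo `H` unless `X` is fed the package — the stubs must take (at least the LOWER half of)
the femto package as input. [folklore] -/
theorem not_forall_continuous_concl_of_xiUnbounded (r : LatticeRep G) (hXi : XiUnbounded r) :
    ¬ ∀ a : ℝ → ℝ, Continuous a → (∀ β, 0 < a β) → Tendsto a atTop (𝓝 0) →
        ∃ (c₁ β₂ : ℝ) (S₁ : ℝ → ℕ), 0 < c₁ ∧ ∀ A B : YMSpecies G, ∃ C : ℝ, ∀ β : ℝ, β₂ ≤ β →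
          ∀ S n : ℕ, S₁ β ≤ S → n ≤ S →
            |latticeConnectedCorr r.ρ β (2 * S + 1) A.F B.F n| ≤ C * Real.exp (-(c₁ * a β * n)) := by
  intro h
  obtain ⟨βs, -, hIR⟩ := not_concl_of_xiUnbounded_of_slow r hXi
  obtain ⟨a, ha, -, hpos, -, hlim, -, hslow⟩ := exists_continuous_slow_ruler (fun _ => 0) βs
  exact hIR a hslow (h a ha hpos hlim)

end IR

/-! ## The upper-only crux: implies the crux, false modulo `XiUnbounded` -/

/-- Deleting the LOWER bound from the femto package weakens the hypothesis: the UPPER-ONLY crux (the body of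
`LatticeGapInUVUnitsC` with the conjunct `c * Γ ((n : ℝ) * a β) ≤ (n : ℝ) ^ 8 * cov …` removed, verbatim otherwise)
implies the crux. [folklore] -/
theorem latticeGapInUVUnitsC_of_upperOnly
    (h : ∀ (G : Type) [Group G] [TopologicalSpace G] [IsTopologicalGroup G] [CompactSpace G], IsCompactSimpleLieGroup G → letI : MeasurableSpace G := borel G; haveI : BorelSpace G := ⟨rfl⟩; ∀ (r : LatticeRep G) (a : ℝ → ℝ), Continuous a → (∃ (Γ : ℝ → ℝ) (β₀ ℓ₀ c C : ℝ), 0 < ℓ₀ ∧ 0 < c ∧ (∀ β, 0 < a β) ∧ Filter.Tendsto a Filter.atTop (nhds 0) ∧ (∀ s : ℝ, 0 < s → s ≤ ℓ₀ → 0 < Γ s ∧ Γ s ≤ 1) ∧ ∀ (L : ℕ) [NeZero L] (β : ℝ), β₀ ≤ β → (L : ℝ) * a β ≤ ℓ₀ → let P : (Fin 4 → ZMod L) → Fin 4 → Fin 4 → GaugeConfig 4 L G → ℝ := fun x i j U => (r.N : ℝ) - (r.ρ (plaquetteHolonomy U x i j)).trace.re; let E : (GaugeConfig 4 L G → ℝ)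 → ℝ := fun F => wilsonExpectation (d := 4) (L := L) r.ρ β F; let cov : (GaugeConfig 4 L G → ℝ) → (GaugeConfig 4 L G → ℝ) → ℝ := fun F F' => E (fun U => F U * F' U) - E F * E F'; let dist : (Fin 4 → ZMod L) → (Fin 4 → ZMod L) → ℝ := fun x y => Real.sqrt (∑ k : Fin 4, (((x k - y k).valMinAbs : ℤ) : ℝ) ^ 2); (∀ n : ℕ, 1 ≤ n → 8 * n ≤ L → (n : ℝ) ^ 8 * cov (P 0 0 1) (P (Pi.single (2 : Fin 4) ((n : ℕ) : ZMod L)) 0 1) ≤ C * Γ ((n : ℝ) * a β)) ∧ (∀ (x y : Fin 4 → ZMod L) (i j i' j' : Fin 4), x ≠ y → i ≠ j → i' ≠ j' → |cov (P x i j) (P y i' j')| * dist x y ^ 8 ≤ C * Γ (dist x y * a β))) → ∃ (c₁ β₂ : ℝ) (S₁ : ℝ → ℕ), 0 < c₁ ∧ ∀ A B : YMSpecies G, ∃ C : ℝ, ∀ β : ℝ, β₂ ≤ β → ∀ S n : ℕ, S₁ β ≤ S → n ≤ S → |latticeConnectedCorr r.ρ β (2 * S + 1) A.F B.F n| ≤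 C * Real.exp (-(c₁ * a β * n))) :
    LatticeGapInUVUnitsC := by
  intro G _ _ _ _ hG r a ha hP
  obtain ⟨Γ, β₀, ℓ₀, c, C, hℓ, hc, hpos, hlim, hΓ, hbox⟩ := hP
  exact h G hG r a ha ⟨Γ, β₀, ℓ₀, c, C, hℓ, hc, hpos, hlim, hΓ, fun L _ β h₁ h₂ =>
    ⟨fun n hn hnL => ((hbox L β h₁ h₂).1 n hn hnL).2, (hbox L β h₁ h₂).2⟩⟩

/-- **Negative lemma: the package's LOWER bound is load-bearing in `LatticeGapInUVUnitsC` — modulo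
`XiUnbounded (suFund N)` (`N ≥ 2`) the upper-only crux is false.** `SU(N)` is compact simple unconditionally;
`exists_slow_continuous_package_id` (proved concentration + continuous slow rulers) gives, above the bad couplings `βs j` of `XiUnbounded`, a CONTINUOUS admissible unit map for the upper-only package
with the vanishing shape `Γ(s) = s`, `β₀ = 0`, and `a (βs j) ≥ 1/(j+1)`; the upper-only crux then clusters at rate
`c₁ a(βs j) ≥ c₁/(j+1) > 1/(j+1)²` on large tori, against the choice of `βs j`. So "continuity pins the ruler to the
physical scale" is exactly "continuity AND the two-sided clause": a proof of the crux that does not use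
`c Γ(n a β) ≤ n⁸ Cov` proves `ξ` BOUNDED for every `SU(N)`. [folklore] -/
theorem latticeGapInUVUnitsC_upperOnly_false_of_xiUnbounded {N : ℕ} (hN : 2 ≤ N)
    (hXi : letI : MeasurableSpace (Matrix.specialUnitaryGroup (Fin N) ℂ) := borel _;
      haveI : BorelSpace (Matrix.specialUnitaryGroup (Fin N) ℂ) := ⟨rfl⟩; XiUnbounded (suFund N)) :
    ¬ ∀ (G : Type) [Group G] [TopologicalSpace G] [IsTopologicalGroup G] [CompactSpace G], IsCompactSimpleLieGroup G → letI : MeasurableSpace G := borel G; haveI : BorelSpace G := ⟨rfl⟩; ∀ (r : LatticeRep G) (a : ℝ → ℝ), Continuous a → (∃ (Γ : ℝ → ℝ) (β₀ ℓ₀ c C : ℝ), 0 < ℓ₀ ∧ 0 < c ∧ (∀ β, 0 < a β) ∧ Filter.Tendsto a Filter.atTop (nhds 0) ∧ (∀ s : ℝ, 0 < s → s ≤ ℓ₀ → 0 < Γ s ∧ Γ s ≤ 1) ∧ ∀ (L : ℕ) [NeZero L] (β : ℝ), β₀ ≤ β → (L : ℝ) * a β ≤ ℓ₀ → let P : (Fin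 4 → ZMod L) → Fin 4 → Fin 4 → GaugeConfig 4 L G → ℝ := fun x i j U => (r.N : ℝ) - (r.ρ (plaquetteHolonomy U x i j)).trace.re; let E : (GaugeConfig 4 L G → ℝ) → ℝ := fun F => wilsonExpectation (d := 4) (L := L) r.ρ β F; let cov : (GaugeConfig 4 L G → ℝ) → (GaugeConfig 4 L G → ℝ) → ℝ := fun F F' => E (fun U => F U * F' U) - E F * E F'; let dist : (Fin 4 → ZMod L) → (Fin 4 → ZMod L) → ℝ := fun x y => Real.sqrt (∑ k : Fin 4, (((x k - y k).valMinAbs : ℤ) : ℝ) ^ 2); (∀ n : ℕ, 1 ≤ n → 8 * n ≤ L → (n : ℝ) ^ 8 * cov (P 0 0 1) (P (Pi.single (2 : Fin 4) ((n : ℕ) : ZMod L)) 0 1) ≤ C * Γ ((n : ℝ) * a β)) ∧ (∀ (x y : Fin 4 → ZMod L) (i j i' j' : Fin 4), x ≠ y → i ≠ j → i' ≠ j' → |cov (P x i j) (P y i' j')| * dist x y ^ 8 ≤ C * Γ (dist x y * a β))) → ∃ (c₁ β₂ : ℝ) (S₁ : ℝ → ℕ), 0 < c₁ ∧ ∀ A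 B : YMSpecies G, ∃ C : ℝ, ∀ β : ℝ, β₂ ≤ β → ∀ S n : ℕ, S₁ β ≤ S → n ≤ S → |latticeConnectedCorr r.ρ β (2 * S + 1) A.F B.F n| ≤ C * Real.exp (-(c₁ * a β * n)) := by
  intro hcrux
  letI : MeasurableSpace (Matrix.specialUnitaryGroup (Fin N) ℂ) := borel _
  haveI : BorelSpace (Matrix.specialUnitaryGroup (Fin N) ℂ) := ⟨rfl⟩
  have hG : IsCompactSimpleLieGroup (Matrix.specialUnitaryGroup (Fin N) ℂ) :=
    isCompactSimpleLieGroup_specialUnitaryGroup isSimpleCompactGroup_specialUnitaryGroup_holds hN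
  obtain ⟨βs, -, hIR⟩ := not_concl_of_xiUnbounded_of_slow (suFund N) hXi
  obtain ⟨a, ha, hpos, hlim, hbox, hslow⟩ := exists_slow_continuous_package_id (suFund N) βs
  exact hIR a hslow (hcrux (Matrix.specialUnitaryGroup (Fin N) ℂ) hG (suFund N) a ha
    ⟨fun s => s, 0, 1, 1, 1, one_pos, one_pos, hpos, hlim, fun s hs hs1 => ⟨hs, hs1⟩, fun L _ β h₁ h₂ =>
      ⟨fun n hn hnL => ((hbox L β h₁ h₂).1 n hn hnL).2, (hbox L β h₁ h₂).2⟩⟩)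


/-! ## The sign-only crux (`0 < c` weakened to `0 ≤ c`): implies the crux, false modulo `XiUnbounded` -/

/-- Weakening `0 < c` to `0 ≤ c` in the femto package weakens the hypothesis: the SIGN-ONLY crux (the body of
`LatticeGapInUVUnitsC` with `0 < c` replaced by `0 ≤ c`, verbatim otherwise) implies the crux. [folklore] -/
theorem latticeGapInUVUnitsC_of_signOnly
    (h : ∀ (G : Type) [Group G] [TopologicalSpace G] [IsTopologicalGroup G] [CompactSpace G], IsCompactSimpleLieGroup G → letI : MeasurableSpace G := borel G; haveI : BorelSpace G := ⟨rfl⟩; ∀ (r : LatticeRep G) (a : ℝ → ℝ), Continuous a → (∃ (Γ : ℝ → ℝ) (β₀ ℓ₀ c C : ℝ), 0 < ℓ₀ ∧ 0 ≤ c ∧ (∀ β, 0 < a β) ∧ Filter.Tendsto a Filter.atTop (nhds 0) ∧ (∀ s : ℝ, 0 < s → s ≤ ℓ₀ → 0 < Γ s ∧ Γ s ≤ 1) ∧ ∀ (L : ℕ) [NeZero L] (β : ℝ), β₀ ≤ β → (L : ℝ) * a β ≤ ℓ₀ → let P : (Fin 4 → ZMod L) → Fin 4 → Fin 4 → GaugeConfig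 4 L G → ℝ := fun x i j U => (r.N : ℝ) - (r.ρ (plaquetteHolonomy U x i j)).trace.re; let E : (GaugeConfig 4 L G → ℝ) → ℝ := fun F => wilsonExpectation (d := 4) (L := L) r.ρ β F; let cov : (GaugeConfig 4 L G → ℝ) → (GaugeConfig 4 L G → ℝ) → ℝ := fun F F' => E (fun U => F U * F' U) - E F * E F'; let dist : (Fin 4 → ZMod L) → (Fin 4 → ZMod L) → ℝ := fun x y => Real.sqrt (∑ k : Fin 4, (((x k - y k).valMinAbs : ℤ) : ℝ) ^ 2); (∀ n : ℕ, 1 ≤ n → 8 * n ≤ L → c * Γ ((n : ℝ) * a β) ≤ (n : ℝ) ^ 8 * cov (P 0 0 1) (P (Pi.single (2 : Fin 4) ((n : ℕ) : ZMod L)) 0 1) ∧ (n : ℝ) ^ 8 * cov (P 0 0 1) (P (Pi.single (2 : Fin 4) ((n : ℕ) : ZMod L)) 0 1) ≤ C * Γ ((n : ℝ) * a β)) ∧ (∀ (x y : Fin 4 → ZMod L) (i j i' j' : Fin 4), x ≠ y → i ≠ j → i' ≠ j' → |cov (P x i j) (P y i' j')| * dist x y ^ 8 ≤ C * Γ (dist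 x y * a β))) → ∃ (c₁ β₂ : ℝ) (S₁ : ℝ → ℕ), 0 < c₁ ∧ ∀ A B : YMSpecies G, ∃ C : ℝ, ∀ β : ℝ, β₂ ≤ β → ∀ S n : ℕ, S₁ β ≤ S → n ≤ S → |latticeConnectedCorr r.ρ β (2 * S + 1) A.F B.F n| ≤ C * Real.exp (-(c₁ * a β * n))) :
    LatticeGapInUVUnitsC := by
  intro G _ _ _ _ hG r a ha hP
  obtain ⟨Γ, β₀, ℓ₀, c, C, hℓ, hc, hpos, hlim, hΓ, hbox⟩ := hP
  exact h G hG r a ha ⟨Γ, β₀, ℓ₀, c, C, hℓ, hc.le, hpos, hlim, hΓ, fun L _ β h₁ h₂ => hbox L β h₁ h₂⟩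

/-- **Negative lemma: the STRICT positivity `0 < c` of the lower constant is load-bearing — the lower clause must
carry SIZE, not only SIGN.** Modulo `XiUnbounded (suFund N)` (`N ≥ 2`) the sign-only crux is false: with `c = 0` the
lower clause is the reflection-positivity THEOREM `0 ≤ Cov(P_0^{01}, P_{ne₂}^{01})` (`axisPlaquetteCov_nonneg`, every
torus, every `β ≥ 0`), so the slow continuous rulers of `exists_slow_continuous_package_id` (shape `Γ(s) = s`, `β₀ = 0`) are
admissible and the IR bookkeeping bites. For provers: the femto lower bound enters any proof through its SIZE `c Γ(s) > 0` on the
level sets `n a(β) = s` (as in `ruler_lt_of_continuous` / the ratchet's seed), never through positivity alone.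
[folklore] -/
theorem latticeGapInUVUnitsC_signOnly_false_of_xiUnbounded {N : ℕ} (hN : 2 ≤ N)
    (hXi : letI : MeasurableSpace (Matrix.specialUnitaryGroup (Fin N) ℂ) := borel _;
      haveI : BorelSpace (Matrix.specialUnitaryGroup (Fin N) ℂ) := ⟨rfl⟩; XiUnbounded (suFund N)) :
    ¬ ∀ (G : Type) [Group G] [TopologicalSpace G] [IsTopologicalGroup G] [CompactSpace G], IsCompactSimpleLieGroup G → letI : MeasurableSpace G := borel G; haveI : BorelSpace G := ⟨rfl⟩; ∀ (r : LatticeRep G) (a : ℝ → ℝ), Continuous a → (∃ (Γ : ℝ → ℝ) (β₀ ℓ₀ c C : ℝ), 0 < ℓ₀ ∧ 0 ≤ c ∧ (∀ β, 0 < a β) ∧ Filter.Tendsto a Filter.atTop (nhds 0) ∧ (∀ s : ℝ, 0 < s → s ≤ ℓ₀ → 0 < Γ s ∧ Γ s ≤ 1) ∧ ∀ (L : ℕ) [NeZero L] (β : ℝ), β₀ ≤ β → (L : ℝ) * a β ≤ ℓ₀ → let P : (Fin 4 → ZMod L) → Fin 4 → Fin 4 → GaugeConfig 4 L G → ℝ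 := fun x i j U => (r.N : ℝ) - (r.ρ (plaquetteHolonomy U x i j)).trace.re; let E : (GaugeConfig 4 L G → ℝ) → ℝ := fun F => wilsonExpectation (d := 4) (L := L) r.ρ β F; let cov : (GaugeConfig 4 L G → ℝ) → (GaugeConfig 4 L G → ℝ) → ℝ := fun F F' => E (fun U => F U * F' U) - E F * E F'; let dist : (Fin 4 → ZMod L) → (Fin 4 → ZMod L) → ℝ := fun x y => Real.sqrt (∑ k : Fin 4, (((x k - y k).valMinAbs : ℤ) : ℝ) ^ 2); (∀ n : ℕ, 1 ≤ n → 8 * n ≤ L → c * Γ ((n : ℝ) * a β) ≤ (n : ℝ) ^ 8 * cov (P 0 0 1) (P (Pi.single (2 : Fin 4) ((n : ℕ) : ZMod L)) 0 1) ∧ (n : ℝ) ^ 8 * cov (P 0 0 1) (P (Pi.single (2 : Fin 4) ((n : ℕ) : ZMod L)) 0 1) ≤ C * Γ ((n : ℝ) * a β)) ∧ (∀ (x y : Fin 4 → ZMod L) (i j i' j' : Fin 4), x ≠ y → i ≠ j → i' ≠ j' → |cov (P x i j) (P y i' j')| * dist x y ^ 8 ≤ C * Γ (dist x y * a β))) →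 ∃ (c₁ β₂ : ℝ) (S₁ : ℝ → ℕ), 0 < c₁ ∧ ∀ A B : YMSpecies G, ∃ C : ℝ, ∀ β : ℝ, β₂ ≤ β → ∀ S n : ℕ, S₁ β ≤ S → n ≤ S → |latticeConnectedCorr r.ρ β (2 * S + 1) A.F B.F n| ≤ C * Real.exp (-(c₁ * a β * n)) := by
  intro hcrux
  letI : MeasurableSpace (Matrix.specialUnitaryGroup (Fin N) ℂ) := borel _
  haveI : BorelSpace (Matrix.specialUnitaryGroup (Fin N) ℂ) := ⟨rfl⟩
  have hG : IsCompactSimpleLieGroup (Matrix.specialUnitaryGroup (Fin N) ℂ) :=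
    isCompactSimpleLieGroup_specialUnitaryGroup isSimpleCompactGroup_specialUnitaryGroup_holds hN
  obtain ⟨βs, -, hIR⟩ := not_concl_of_xiUnbounded_of_slow (suFund N) hXi
  obtain ⟨a, ha, hpos, hlim, hbox, hslow⟩ := exists_slow_continuous_package_id (suFund N) βs
  exact hIR a hslow (hcrux (Matrix.specialUnitaryGroup (Fin N) ℂ) hG (suFund N) a ha
    ⟨fun s => s, 0, 1, 0, 1, one_pos, le_rfl, hpos, hlim, fun s hs hs1 => ⟨hs, hs1⟩, fun L _ β h₁ h₂ =>
      hbox L β h₁ h₂⟩)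

end

end Summit.QuantumFields.YangMills.Theorems.LatticeGapInUVUnitsC.Negative
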